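import Literature.MathematicalPhysics.QuantumManyBody.BoseEinsteinCondensation
import Mathlib.InformationTheory.KullbackLeibler.KLFun
import Mathlib.MeasureTheory.Integral.Bochner.Set
import HarnessLib

/-!
# Route `BECCellInformation`, crux `CellInformationBound` (stmt-AtomisticToContinuum-13439),
# line registered (`Lines/birth.lean`): the registered stub `stub_varianceToInformation`

Supports (does not close) stmt-AtomisticToContinuum-13439; stub `stub_varianceToInformation`
(`VarianceToInformation`) of the birth line "information is dominated by variance".

**`KL ≤ χ²` for the cell functionals, every trial state.** For every `n, L, M` and every trial
state `Ψ ∈ TrialState (n+1) L`, with the `M³` half-open cells of side `L/M`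
(`cell k = Π_j [k_j L/M, (k_j+1) L/M)`, `k : Fin 3 → Fin M`), the tagged-boson cell masses
`A_k(Y) = ∫_(cell k) ‖Ψ(x,Y)‖² dx`, the slice mass `m(Y) = ∫ ‖Ψ(z,Y)‖² dz` and the cell
probabilities `P_k = ∫ A_k(Y') dY'` satisfy

`∫⁻ dY ofReal (Σ_k m(Y) P_k klFun (A_k(Y) / (m(Y) P_k)))
   ≤ ∫⁻ dY ofReal (Σ_k (A_k(Y) − m(Y) P_k)² / (m(Y) P_k))`,

i.e. the coarse mutual information integrand is dominated by the `χ²`-integrand.  The proof is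
TERMWISE and purely real: for `a ≥ 0` and `D = m P ≥ 0`,
`D · klFun (a/D) ≤ D · (a/D − 1)² = (a − D)²/D` when `D > 0` (from `klFun t ≤ (t − 1)²` for
`t ≥ 0`, itself `log t ≤ t − 1`), while for `D = 0` both sides vanish (`x / 0 = 0`,
`0 · klFun _ = 0`).  Then `Finset.sum_le_sum`, `ENNReal.ofReal_le_ofReal`, `lintegral_mono`; the
only analytic input is `0 ≤ ∫ ‖Ψ‖²` (`integral_nonneg`).  No positivity, normalisation, `L > 0` or
`M > 0` is needed.

## References

* T. M. Cover, J. A. Thomas, *Elements of Information Theory* (2nd ed., 2005), Lemma 11.6.1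
  (the bound `D(P‖Q) ≤ χ²(P‖Q)` via `log x ≤ x − 1`).  [cite: CoverThomas2005, Lemma 11.6.1]
* Mathlib `InformationTheory.klFun`, `Real.log_le_sub_one_of_pos`.
-/

noncomputable section

open MeasureTheory
open scoped ENNReal

namespace Summit.AtomisticToContinuum.BoseEinsteinCondensation.Theorems.CellInformationBound

open Literature.MathematicalPhysics.QuantumManyBody.BoseGas

namespace VarianceToInformation

/-! ### The scalar inequality `KL ≤ χ²` -/

/-- `klFun t ≤ (t - 1)²` for `t ≥ 0`: for `t > 0` this is `t log t ≤ t (t - 1)`, i.e.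
`log t ≤ t - 1`; at `t = 0` both sides are `1`. [cite: CoverThomas2005, Lemma 11.6.1] -/
theorem klFun_le_sq {t : ℝ} (ht : 0 ≤ t) : InformationTheory.klFun t ≤ (t - 1) ^ 2 := by
  rcases ht.eq_or_lt with rfl | ht
  · simp [InformationTheory.klFun_zero]
  · rw [InformationTheory.klFun_apply]
    nlinarith [mul_le_mul_of_nonneg_left (Real.log_le_sub_one_of_pos ht) ht.le]

/-- The termwise bound, in the syntactic shape of the stub: for `a, m, P ≥ 0`,
`m P · klFun (a / (m P)) ≤ (a - m P)² / (m P)` (both sides `0` when `m P = 0`).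
[cite: CoverThomas2005, Lemma 11.6.1] -/
theorem mul_klFun_div_le {a m P : ℝ} (ha : 0 ≤ a) (hm : 0 ≤ m) (hP : 0 ≤ P) :
    m * P * InformationTheory.klFun (a / (m * P)) ≤ (a - m * P) ^ 2 / (m * P) := by
  have hD : 0 ≤ m * P := mul_nonneg hm hP
  rcases hD.eq_or_lt with hD0 | hDpos
  · rw [← hD0]
    simp
  · calc m * P * InformationTheory.klFun (a / (m * P))
        ≤ m * P * (a / (m * P) - 1) ^ 2 :=
          mul_le_mul_of_nonneg_left (klFun_le_sq (div_nonneg ha hD)) hD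
      _ = (a - m * P) ^ 2 / (m * P) := by
          have hne : m * P ≠ 0 := hDpos.ne'
          rw [div_sub_one hne, div_pow, ← mul_div_assoc, sq (m * P), mul_div_mul_left _ _ hne]

end VarianceToInformation

/-! ### The stub -/

open VarianceToInformation in
/-- **Stub `stub_varianceToInformation` of the birth line — `KL ≤ χ²` for the cell functionals,
every trial state.** For every `n, L, M` and every `Ψ ∈ TrialState (n+1) L`, with cells of side
`L/M`: `∫⁻ dY ofReal (Σ_k m(Y) P_k klFun (A_k(Y)/(m(Y) P_k))) ≤ ∫⁻ dY ofReal (Σ_k (A_k(Y) − m(Y) P_k)²/(m(Y) P_k))`.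
Termwise `m P klFun (a/(m P)) ≤ (a − m P)²/(m P)` for `a, m, P ≥ 0` (`mul_klFun_div_le`, the three
non-negativities being `integral_nonneg` of `‖Ψ‖² ≥ 0`), then `Finset.sum_le_sum`,
`ENNReal.ofReal_le_ofReal`, `lintegral_mono`. [cite: CoverThomas2005, Lemma 11.6.1] -/
theorem stub_varianceToInformation :
    ∀ (n : ℕ) (L : ℝ) (M : ℕ) (Ψ : Literature.MathematicalPhysics.QuantumManyBody.BoseGas.TrialState (n + 1) L), ∫⁻ Y : Literature.MathematicalPhysics.QuantumManyBody.BoseGas.Config n, ENNReal.ofReal (∑ k : Fin 3 → Fin M, (∫ z, ‖Ψ.ψ (Matrix.vecCons z Y)‖ ^ 2) * (∫ Y' : Literature.MathematicalPhysics.QuantumManyBody.BoseGas.Config n, ∫ x in {y : EuclideanSpace ℝ (Fin 3) | ∀ j, y j ∈ Set.Ico (((k j : ℕ) : ℝ) * (L / (M : ℝ))) ((((k j : ℕ) : ℝ) + 1) * (L / (M : ℝ)))}, ‖Ψ.ψ (Matrix.vecCons x Y')‖ ^ 2) * InformationTheory.klFun ((∫ x in {y : EuclideanSpace ℝ (Fin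 3) | ∀ j, y j ∈ Set.Ico (((k j : ℕ) : ℝ) * (L / (M : ℝ))) ((((k j : ℕ) : ℝ) + 1) * (L / (M : ℝ)))}, ‖Ψ.ψ (Matrix.vecCons x Y)‖ ^ 2) / ((∫ z, ‖Ψ.ψ (Matrix.vecCons z Y)‖ ^ 2) * (∫ Y' : Literature.MathematicalPhysics.QuantumManyBody.BoseGas.Config n, ∫ x in {y : EuclideanSpace ℝ (Fin 3) | ∀ j, y j ∈ Set.Ico (((k j : ℕ) : ℝ) * (L / (M : ℝ))) ((((k j : ℕ) : ℝ) + 1) * (L / (M : ℝ)))}, ‖Ψ.ψ (Matrix.vecCons x Y')‖ ^ 2)))) ≤ ∫⁻ Y : Literature.MathematicalPhysics.QuantumManyBody.BoseGas.Config n, ENNReal.ofReal (∑ k : Fin 3 → Fin M, ((∫ x in {y : EuclideanSpace ℝ (Fin 3) | ∀ j, y j ∈ Set.Ico (((k j : ℕ) : ℝ) * (L / (M : ℝ))) ((((k j : ℕ) : ℝ) + 1) * (L / (M : ℝ)))}, ‖Ψ.ψ (Matrix.vecCons x Y)‖ ^ 2) - (∫ z, ‖Ψ.ψ (Matrix.vecCons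 z Y)‖ ^ 2) * (∫ Y' : Literature.MathematicalPhysics.QuantumManyBody.BoseGas.Config n, ∫ x in {y : EuclideanSpace ℝ (Fin 3) | ∀ j, y j ∈ Set.Ico (((k j : ℕ) : ℝ) * (L / (M : ℝ))) ((((k j : ℕ) : ℝ) + 1) * (L / (M : ℝ)))}, ‖Ψ.ψ (Matrix.vecCons x Y')‖ ^ 2)) ^ 2 / ((∫ z, ‖Ψ.ψ (Matrix.vecCons z Y)‖ ^ 2) * (∫ Y' : Literature.MathematicalPhysics.QuantumManyBody.BoseGas.Config n, ∫ x in {y : EuclideanSpace ℝ (Fin 3) | ∀ j, y j ∈ Set.Ico (((k j : ℕ) : ℝ) * (L / (M : ℝ))) ((((k j : ℕ) : ℝ) + 1) * (L / (M : ℝ)))}, ‖Ψ.ψ (Matrix.vecCons x Y')‖ ^ 2))) := by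
  intro n L M Ψ
  refine lintegral_mono fun Y => ENNReal.ofReal_le_ofReal (Finset.sum_le_sum fun k _ => ?_)
  exact mul_klFun_div_le (integral_nonneg fun _ => sq_nonneg _)
    (integral_nonneg fun _ => sq_nonneg _)
    (integral_nonneg fun _ => integral_nonneg fun _ => sq_nonneg _)

end Summit.AtomisticToContinuum.BoseEinsteinCondensation.Theorems.CellInformationBound

end
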